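import Mathlib
import HarnessLib
import Literature.Analysis.FluidPDE.RieszPressureModConst
import Literature.Analysis.FluidPDE.WholeSpaceIBP
import Summits.NavierStokesRegularity.NavierStokesRegularity.Theorems.PoloidalWindowDoorPoloidalWindowRigiditySparseEnergyFarKernel

/-!
# Route `PoloidalWindowDoor`, crux `PoloidalWindowRigidity` (stmt-19708), line `sparse_energy` (cstrat g11) —
# stub S1, FILE C (discharge of the window pressure split), piece C4: OSCILLATION OF THE HARMONIC REMAINDER ⇒ DYADIC CUT-OFF SUMS

Seat ns-poloidal-K2-p2 g10 (successor of the interim LEAD-of-record lineage on 19708; file `--supports`).  The far half of the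
local split of the Riesz pressure modulo constants of a BOUNDED continuous field `u` on the window ball `B̄(a,2R)`: with the
window cut-off `ϑ = cutoff (4R) (a − ·)` (`= 1` on `B̄(a,4R)`, `= 0` off `B(a,8R)`) and far/near scale `0 < r₀ < r₁ ≤ R`, the
harmonic remainder is `p₂ := farPotential r₀ r₁ (ϑ•u) − farPotentialMod r₀ r₁ x₀ u`, and for `x, x' ∈ B̄(a,2R)`

  `p₂ x − p₂ x' = ∫ (ϑ(y)² − 1) (D²Γ∞(x−y) − D²Γ∞(x'−y))(u y, u y) dy`

lives on `|y − a| > 4R`, where the far kernel is Lipschitz at the dyadic rate (`…SparseEnergyFarKernel.abs_fderiv2_newtonFar_apply_sub_le`: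
`≤ 64·c·R·|y−a|⁻⁴·|u(y)|²`); dyadic pigeonhole `2^kR ≤ |y−a| < 2^{k+1}R` puts every such `y` under ONE term of the series
`Σ_k (2^kR)⁻⁴ cutoff(2^{k+1}R)(a−y)`, and monotone convergence (`lintegral_tsum`, everything nonnegative, so no pointwise summability
is needed) gives

  `osc_{B̄(a,2R)} p₂ ≤ 64·c·R · Σ'_k ((2^kR)⁻¹)⁴ ∫ cutoff(2^{k+1}R)(a−y) |u y|² dy`,

the series being summable for bounded `u` (`summable_dyadicEnergy`: terms `≤ (64N²|B₁|/R)·2⁻ᵏ`).  Packaged with a universal constant as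
`exists_farOscillation` — the `p₂`-clause of the window pressure split `hwin` of `…SparseEnergyScaledEnergyOfSplit.scaledEnergy_of_split`.

WHAT THIS IS NOT: not a claim about Navier–Stokes; potential theory of bounded fields (bears_on LADDER-NS N0 via crux 19708, line
sparse_energy, stub S1). [folklore]
-/

noncomputable section

-- the summit and its single sub-problem share the name (CONVENTIONS §1), as in every Theorems file
set_option linter.dupNamespace false

namespace Summit.NavierStokesRegularity.NavierStokesRegularity.Theorems.PoloidalWindowDoorPoloidalWindowRigiditySparseEnergyFarOscillation

-- nested operator types `ℝ³ →L[ℝ] ℝ³ →L[ℝ] ℝ³ →L[ℝ] ℝ`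
set_option maxSynthPendingDepth 3

open MeasureTheory Set Function Filter Topology Metric
open scoped ENNReal
open Literature.Analysis Literature.Analysis.FluidPDE
open Summit.NavierStokesRegularity.NavierStokesRegularity.Theorems.PoloidalWindowDoorPoloidalWindowRigiditySparseEnergyFarKernel

variable {u : EuclideanSpace ℝ (Fin 3) → EuclideanSpace ℝ (Fin 3)} {N : ℝ}

/-! ### Local energies against the dyadic cut-offs are summable for bounded fields -/

/-- The translated cut-off `y ↦ cutoff ρ (a − y)` has compact support (inside `B̄(a,2ρ)`), `ρ > 0`. [folklore] -/
theorem hasCompactSupport_cutoff_sub {ρ : ℝ} (hρ : 0 < ρ) (a : EuclideanSpace ℝ (Fin 3)) :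
    HasCompactSupport fun y : EuclideanSpace ℝ (Fin 3) => cutoff ρ (a - y) := by
  refine HasCompactSupport.intro (isCompact_closedBall a (2 * ρ)) fun y hy => ?_
  rw [mem_closedBall, dist_eq_norm, not_le] at hy
  exact cutoff_eq_zero hρ (by rw [← norm_neg, neg_sub]; exact hy.le)

/-- The local energy integrand `cutoff ρ (a − y) |u y|²` is continuous, compactly supported, hence integrable, for continuous `u`. [folklore] -/
theorem integrable_cutoff_mul_norm_sq (hu : Continuous u) {ρ : ℝ} (hρ : 0 < ρ) (a : EuclideanSpace ℝ (Fin 3)) :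
    Integrable fun y : EuclideanSpace ℝ (Fin 3) => cutoff ρ (a - y) * ‖u y‖ ^ 2 := by
  have hc : Continuous fun y : EuclideanSpace ℝ (Fin 3) => cutoff ρ (a - y) * ‖u y‖ ^ 2 :=
    ((contDiff_cutoff (n := 0) ρ).continuous.comp (continuous_const.sub continuous_id)).mul (hu.norm.pow 2)
  exact hc.integrable_of_hasCompactSupport (hasCompactSupport_cutoff_sub hρ a).mul_right

/-- **The local energy at scale `ρ` of a bounded field**: `∫ cutoff ρ (a − y) |u y|² dy ≤ N² · (2ρ)³ · |B(0,1)|` when `|u| ≤ N`. [folklore] -/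
theorem integral_cutoff_mul_norm_sq_le (hN : ∀ y, ‖u y‖ ≤ N) {ρ : ℝ} (hρ : 0 < ρ) (a : EuclideanSpace ℝ (Fin 3)) :
    ∫ y, cutoff ρ (a - y) * ‖u y‖ ^ 2 ≤
      N ^ 2 * ((2 * ρ) ^ 3 * (volume : Measure (EuclideanSpace ℝ (Fin 3))).real (ball 0 1)) := by
  have hind : ∀ y, cutoff ρ (a - y) * ‖u y‖ ^ 2 ≤ (closedBall a (2 * ρ)).indicator (fun _ => N ^ 2) y := by
    intro y
    by_cases hy : y ∈ closedBall a (2 * ρ)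
    · rw [indicator_of_mem hy]
      calc cutoff ρ (a - y) * ‖u y‖ ^ 2 ≤ 1 * ‖u y‖ ^ 2 := by
            gcongr
            exact cutoff_le_one _ _
        _ ≤ N ^ 2 := by rw [one_mul]; exact pow_le_pow_left₀ (norm_nonneg _) (hN y) 2
    · rw [indicator_of_notMem hy]
      rw [mem_closedBall, dist_eq_norm, not_le] at hy
      rw [cutoff_eq_zero hρ (by rw [← norm_neg, neg_sub]; exact hy.le), zero_mul]
  have hint : Integrable ((closedBall a (2 * ρ)).indicator fun _ : EuclideanSpace ℝ (Fin 3) => N ^ 2)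
      (volume : Measure (EuclideanSpace ℝ (Fin 3))) :=
    (integrable_indicator_iff measurableSet_closedBall).2
      ((integrableOn_const_iff (C := N ^ 2)).2 (Or.inr measure_closedBall_lt_top))
  calc ∫ y, cutoff ρ (a - y) * ‖u y‖ ^ 2 ≤ ∫ y, (closedBall a (2 * ρ)).indicator (fun _ => N ^ 2) y :=
        integral_mono_of_nonneg (Eventually.of_forall fun y => mul_nonneg (cutoff_nonneg _ _) (sq_nonneg _)) hint
          (Eventually.of_forall hind)
    _ = N ^ 2 * (volume : Measure (EuclideanSpace ℝ (Fin 3))).real (closedBall a (2 * ρ)) := by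
        rw [integral_indicator_const _ measurableSet_closedBall, smul_eq_mul, mul_comm]
    _ = N ^ 2 * ((2 * ρ) ^ 3 * (volume : Measure (EuclideanSpace ℝ (Fin 3))).real (ball 0 1)) := by
        rw [Measure.addHaar_real_closedBall volume a (by positivity), finrank_euclideanSpace_fin]

/-- **The dyadic local energies of a bounded field are summable**: `k ↦ (2^kR)⁻⁴ ∫ cutoff(2^{k+1}R)(a−y)|u y|² dy` has terms
`≤ (64N²|B₁|/R)·2⁻ᵏ`. [folklore] -/
theorem summable_dyadicEnergy (hN : ∀ y, ‖u y‖ ≤ N) {R : ℝ} (hR : 0 < R) (a : EuclideanSpace ℝ (Fin 3)) :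
    Summable fun k : ℕ => ((2 : ℝ) ^ k * R)⁻¹ ^ 4 * ∫ y, cutoff ((2 : ℝ) ^ (k + 1) * R) (a - y) * ‖u y‖ ^ 2 := by
  set V : ℝ := (volume : Measure (EuclideanSpace ℝ (Fin 3))).real (ball 0 1) with hV
  have hV0 : 0 ≤ V := measureReal_nonneg
  have hterm : ∀ k : ℕ, ((2 : ℝ) ^ k * R)⁻¹ ^ 4 * ∫ y, cutoff ((2 : ℝ) ^ (k + 1) * R) (a - y) * ‖u y‖ ^ 2 ≤
      (64 * N ^ 2 * V / R) * (1 / 2) ^ k := by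
    intro k
    have h2k : 0 < (2 : ℝ) ^ k := pow_pos two_pos k
    have hρ : 0 < (2 : ℝ) ^ (k + 1) * R := by positivity
    calc ((2 : ℝ) ^ k * R)⁻¹ ^ 4 * ∫ y, cutoff ((2 : ℝ) ^ (k + 1) * R) (a - y) * ‖u y‖ ^ 2
        ≤ ((2 : ℝ) ^ k * R)⁻¹ ^ 4 * (N ^ 2 * ((2 * ((2 : ℝ) ^ (k + 1) * R)) ^ 3 * V)) := by
          gcongr
          exact integral_cutoff_mul_norm_sq_le hN hρ a
      _ = (64 * N ^ 2 * V / R) * (1 / 2) ^ k := by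
          rw [one_div_pow, pow_succ]
          field_simp
          ring
  refine Summable.of_nonneg_of_le (fun k => ?_) hterm ((summable_geometric_of_lt_one (by norm_num) (by norm_num)).mul_left _)
  exact mul_nonneg (pow_nonneg (inv_nonneg.2 (by positivity)) 4)
    (integral_nonneg fun y => mul_nonneg (cutoff_nonneg _ _) (sq_nonneg _))

/-- The dyadic series is nonnegative. [folklore] -/
theorem tsum_dyadicEnergy_nonneg (R : ℝ) (hR : 0 < R) (a : EuclideanSpace ℝ (Fin 3)) :
    0 ≤ ∑' k : ℕ, ((2 : ℝ) ^ k * R)⁻¹ ^ 4 * ∫ y, cutoff ((2 : ℝ) ^ (k + 1) * R) (a - y) * ‖u y‖ ^ 2 :=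
  tsum_nonneg fun k => mul_nonneg (pow_nonneg (inv_nonneg.2 (by positivity)) 4)
    (integral_nonneg fun y => mul_nonneg (cutoff_nonneg _ _) (sq_nonneg _))

/-! ### The dyadic pigeonhole -/

/-- **Dyadic pigeonhole.**  For `|y − a| > 4R` (`R > 0`) and any `A ≥ 0`:
`A/|y − a|⁴ ≤ Σ'_k ((2^kR)⁻¹)⁴ · cutoff(2^{k+1}R)(a−y) · A` in `ℝ≥0∞` — the shell index `k` with `2^kR ≤ |y−a| < 2^{k+1}R` alone
dominates. [folklore] -/
theorem ofReal_div_pow_four_le_tsum {R : ℝ} (hR : 0 < R) {a y : EuclideanSpace ℝ (Fin 3)} (hy : 4 * R < ‖y - a‖) {A : ℝ}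
    (hA : 0 ≤ A) :
    ENNReal.ofReal (A / ‖y - a‖ ^ 4) ≤
      ∑' k : ℕ, ENNReal.ofReal (((2 : ℝ) ^ k * R)⁻¹ ^ 4 * (cutoff ((2 : ℝ) ^ (k + 1) * R) (a - y) * A)) := by
  have hya : 0 < ‖y - a‖ := by linarith
  have h1 : 1 ≤ ‖y - a‖ / R := by rw [le_div_iff₀ hR]; linarith
  obtain ⟨k, hk1, hk2⟩ := exists_nat_pow_near h1 one_lt_two
  rw [le_div_iff₀ hR] at hk1
  rw [div_lt_iff₀ hR] at hk2
  have h2k : 0 < (2 : ℝ) ^ k * R := by positivity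
  have hcut : cutoff ((2 : ℝ) ^ (k + 1) * R) (a - y) = 1 :=
    cutoff_eq_one (by positivity) (by rw [← norm_neg, neg_sub]; exact hk2.le)
  refine le_trans ?_ (ENNReal.le_tsum k)
  rw [hcut, one_mul]
  refine ENNReal.ofReal_le_ofReal ?_
  rw [div_eq_mul_inv, mul_comm, ← inv_pow]
  gcongr

/-! ### The oscillation of the harmonic remainder -/

section Remainder

variable {r₀ r₁ R : ℝ} {a x₀ : EuclideanSpace ℝ (Fin 3)} {w : EuclideanSpace ℝ (Fin 3) → EuclideanSpace ℝ (Fin 3)}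

/-- **The oscillation integrand.**  With `w = ϑ•u`, `ϑ = cutoff (4R) (a − ·)`, for `u` continuous bounded and `0 < r₀ < r₁`:
`(farPotential r₀ r₁ w x − farPotentialMod r₀ r₁ x₀ u x) − (farPotential r₀ r₁ w x' − farPotentialMod r₀ r₁ x₀ u x')`
`= ∫ (ϑ(y)² − 1)·(D²Γ∞(x−y) − D²Γ∞(x'−y))(u y, u y) dy` (bilinearity; `…RieszPressureModConst.farPotentialMod_sub_farPotentialMod`). [folklore] -/
theorem farRemainder_sub_eq_integral (hu : Continuous u) (hN : ∀ y, ‖u y‖ ≤ N) (h₀ : 0 < r₀) (h₁ : r₀ < r₁) (hR : 0 < R)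
    (hw : w = fun y => cutoff (4 * R) (a - y) • u y) (x x' : EuclideanSpace ℝ (Fin 3)) :
    (farPotential r₀ r₁ w x - farPotentialMod r₀ r₁ x₀ u x) - (farPotential r₀ r₁ w x' - farPotentialMod r₀ r₁ x₀ u x') =
      ∫ y, (cutoff (4 * R) (a - y) ^ 2 - 1) *
        ((fderiv ℝ (fderiv ℝ (newtonFar r₀ r₁)) (x - y) - fderiv ℝ (fderiv ℝ (newtonFar r₀ r₁)) (x' - y)) (u y) (u y)) := by
  have h4R : 0 < 4 * R := by positivity
  -- the compactly supported field `w = ϑ•u`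
  have hϑc : Continuous fun y : EuclideanSpace ℝ (Fin 3) => cutoff (4 * R) (a - y) :=
    (contDiff_cutoff (n := 0) (4 * R)).continuous.comp (continuous_const.sub continuous_id)
  have hwc : Continuous w := by rw [hw]; exact hϑc.smul hu
  have hwcs : HasCompactSupport w := by
    rw [hw]; exact (hasCompactSupport_cutoff_sub h4R a).smul_right
  have hwL2' : Integrable fun y => ‖w y‖ * ‖w y‖ :=
    (hwc.norm.mul hwc.norm).integrable_of_hasCompactSupport hwcs.norm.mul_right
  have hwL2 : Integrable fun y => ‖w y‖ ^ 2 := by simpa only [sq] using hwL2'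
  have hA : Integrable fun y => fderiv ℝ (fderiv ℝ (newtonFar r₀ r₁)) (x - y) (w y) (w y) -
      fderiv ℝ (fderiv ℝ (newtonFar r₀ r₁)) (x' - y) (w y) (w y) :=
    (integrable_farPotential_integrand h₀ h₁ hwc hwL2 x).sub (integrable_farPotential_integrand h₀ h₁ hwc hwL2 x')
  have hB : Integrable fun y => (fderiv ℝ (fderiv ℝ (newtonFar r₀ r₁)) (x - y) -
      fderiv ℝ (fderiv ℝ (newtonFar r₀ r₁)) (x' - y)) (u y) (u y) := integrable_farPotentialMod_integrand h₀ h₁ hu hN x' x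
  have e1 : farPotential r₀ r₁ w x - farPotential r₀ r₁ w x' = ∫ y, (fderiv ℝ (fderiv ℝ (newtonFar r₀ r₁)) (x - y) (w y) (w y) -
      fderiv ℝ (fderiv ℝ (newtonFar r₀ r₁)) (x' - y) (w y) (w y)) := by
    rw [farPotential, farPotential, ← integral_sub (integrable_farPotential_integrand h₀ h₁ hwc hwL2 x)
      (integrable_farPotential_integrand h₀ h₁ hwc hwL2 x')]
  have e2 : farPotentialMod r₀ r₁ x₀ u x - farPotentialMod r₀ r₁ x₀ u x' = ∫ y, (fderiv ℝ (fderiv ℝ (newtonFar r₀ r₁)) (x - y) -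
      fderiv ℝ (fderiv ℝ (newtonFar r₀ r₁)) (x' - y)) (u y) (u y) := by
    rw [farPotentialMod_sub_farPotentialMod h₀ h₁ hu hN x₀ x x', farPotentialMod]
  rw [show (farPotential r₀ r₁ w x - farPotentialMod r₀ r₁ x₀ u x) - (farPotential r₀ r₁ w x' - farPotentialMod r₀ r₁ x₀ u x') =
      (farPotential r₀ r₁ w x - farPotential r₀ r₁ w x') - (farPotentialMod r₀ r₁ x₀ u x - farPotentialMod r₀ r₁ x₀ u x') by ring,
    e1, e2, ← integral_sub hA hB]
  refine integral_congr_ae (Eventually.of_forall fun y => ?_)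
  -- `D²Γ∞(z)(w y, w y) = ϑ(y)² D²Γ∞(z)(u y, u y)`
  have hsm : ∀ z, fderiv ℝ (fderiv ℝ (newtonFar r₀ r₁)) z (w y) (w y) =
      cutoff (4 * R) (a - y) ^ 2 * fderiv ℝ (fderiv ℝ (newtonFar r₀ r₁)) z (u y) (u y) := by
    intro z
    rw [hw]
    simp only [map_smul, smul_apply, smul_eq_mul]
    ring
  simp only [hsm, sub_apply]
  ring

/-- **The pointwise majorant of the oscillation integrand**, in `ℝ≥0∞`: for `x, x' ∈ B̄(a,2R)`, `0 < r₀ < r₁ ≤ R` and every `y`,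
`‖(ϑ(y)² − 1)(D²Γ∞(x−y) − D²Γ∞(x'−y))(u y,u y)‖ ≤ Σ'_k 64·c·R·((2^kR)⁻¹)⁴·cutoff(2^{k+1}R)(a−y)·|u y|²` — zero inside `B̄(a,4R)`,
one dyadic shell outside. [folklore] -/
theorem ofReal_norm_oscIntegrand_le_tsum (h₀ : 0 < r₀) (h₁ : r₀ < r₁) (hR : r₁ ≤ R) {c : ℝ} (hc0 : 0 ≤ c)
    (hc : ∀ z : EuclideanSpace ℝ (Fin 3), z ≠ 0 → ‖fderiv ℝ (fderiv ℝ (fderiv ℝ newtonKernel)) z‖ ≤ c / ‖z‖ ^ 4)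
    {x x' : EuclideanSpace ℝ (Fin 3)} (hx : x ∈ closedBall a (2 * R)) (hx' : x' ∈ closedBall a (2 * R))
    (y : EuclideanSpace ℝ (Fin 3)) :
    ENNReal.ofReal ‖(cutoff (4 * R) (a - y) ^ 2 - 1) *
        ((fderiv ℝ (fderiv ℝ (newtonFar r₀ r₁)) (x - y) - fderiv ℝ (fderiv ℝ (newtonFar r₀ r₁)) (x' - y)) (u y) (u y))‖ ≤
      ∑' k : ℕ, ENNReal.ofReal (64 * c * R *
        (((2 : ℝ) ^ k * R)⁻¹ ^ 4 * (cutoff ((2 : ℝ) ^ (k + 1) * R) (a - y) * ‖u y‖ ^ 2))) := by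
  have hRpos : 0 < R := (h₀.trans h₁).trans_le hR
  have h4R : 0 < 4 * R := by positivity
  by_cases hfar : ‖y - a‖ ≤ 4 * R
  · -- inside `B̄(a,4R)` the integrand vanishes
    have h1 : cutoff (4 * R) (a - y) = 1 := cutoff_eq_one h4R (by rw [← norm_neg, neg_sub]; exact hfar)
    rw [h1]
    simp
  · rw [not_le] at hfar
    have hϑ := cutoff_nonneg (4 * R) (a - y)
    have hϑ1 := cutoff_le_one (4 * R) (a - y)
    have hfac : |cutoff (4 * R) (a - y) ^ 2 - 1| ≤ 1 := by
      rw [abs_le]; constructor <;> nlinarith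
    have hker := abs_fderiv2_newtonFar_apply_sub_le h₀ h₁ hR hc0 hc hx hx' hfar.le (u y)
    have hbd : ‖(cutoff (4 * R) (a - y) ^ 2 - 1) *
        ((fderiv ℝ (fderiv ℝ (newtonFar r₀ r₁)) (x - y) - fderiv ℝ (fderiv ℝ (newtonFar r₀ r₁)) (x' - y)) (u y) (u y))‖ ≤
        64 * c * R * ‖u y‖ ^ 2 / ‖y - a‖ ^ 4 := by
      rw [Real.norm_eq_abs, abs_mul, sub_apply, sub_apply]
      calc |cutoff (4 * R) (a - y) ^ 2 - 1| *
            |fderiv ℝ (fderiv ℝ (newtonFar r₀ r₁)) (x - y) (u y) (u y) - fderiv ℝ (fderiv ℝ (newtonFar r₀ r₁)) (x' - y) (u y) (u y)|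
          ≤ 1 * (64 * c * R / ‖y - a‖ ^ 4 * ‖u y‖ ^ 2) := by gcongr
        _ = 64 * c * R * ‖u y‖ ^ 2 / ‖y - a‖ ^ 4 := by ring
    calc _ ≤ ENNReal.ofReal (64 * c * R * ‖u y‖ ^ 2 / ‖y - a‖ ^ 4) := ENNReal.ofReal_le_ofReal hbd
      _ ≤ ∑' k : ℕ, ENNReal.ofReal (((2 : ℝ) ^ k * R)⁻¹ ^ 4 *
            (cutoff ((2 : ℝ) ^ (k + 1) * R) (a - y) * (64 * c * R * ‖u y‖ ^ 2))) :=
          ofReal_div_pow_four_le_tsum hRpos hfar (by positivity)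
      _ = _ := by
          refine tsum_congr fun k => ?_
          congr 1
          ring

/-- **Oscillation of the harmonic remainder over the window ball.**  Let `u` be continuous with `|u| ≤ N`, `0 < r₀ < r₁ ≤ R`,
`ϑ = cutoff (4R) (a − ·)`, `w = ϑ•u`, and `c` the constant of `…SparseEnergyFarKernel.exists_norm_fderiv3_newtonKernel_le`.  Then for
`x, x' ∈ B̄(a,2R)`:
`|(farPotential r₀ r₁ w x − farPotentialMod r₀ r₁ x₀ u x) − (farPotential r₀ r₁ w x' − farPotentialMod r₀ r₁ x₀ u x')|`
`≤ 64·c·R · Σ'_k ((2^kR)⁻¹)⁴ ∫ cutoff(2^{k+1}R)(a−y)|u y|² dy` (monotone convergence in `ℝ≥0∞`). [folklore] -/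
theorem abs_farRemainder_sub_le (hu : Continuous u) (hN : ∀ y, ‖u y‖ ≤ N) (h₀ : 0 < r₀) (h₁ : r₀ < r₁)
    (hR : r₁ ≤ R) {c : ℝ} (hc0 : 0 ≤ c)
    (hc : ∀ z : EuclideanSpace ℝ (Fin 3), z ≠ 0 → ‖fderiv ℝ (fderiv ℝ (fderiv ℝ newtonKernel)) z‖ ≤ c / ‖z‖ ^ 4)
    (hw : w = fun y => cutoff (4 * R) (a - y) • u y)
    {x x' : EuclideanSpace ℝ (Fin 3)} (hx : x ∈ closedBall a (2 * R)) (hx' : x' ∈ closedBall a (2 * R)) :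
    |(farPotential r₀ r₁ w x - farPotentialMod r₀ r₁ x₀ u x) - (farPotential r₀ r₁ w x' - farPotentialMod r₀ r₁ x₀ u x')| ≤
      64 * c * R * ∑' k : ℕ, ((2 : ℝ) ^ k * R)⁻¹ ^ 4 * ∫ y, cutoff ((2 : ℝ) ^ (k + 1) * R) (a - y) * ‖u y‖ ^ 2 := by
  have hRpos : 0 < R := (h₀.trans h₁).trans_le hR
  -- the integrand and its dyadic majorants
  set I : EuclideanSpace ℝ (Fin 3) → ℝ := fun y => (cutoff (4 * R) (a - y) ^ 2 - 1) *
    ((fderiv ℝ (fderiv ℝ (newtonFar r₀ r₁)) (x - y) - fderiv ℝ (fderiv ℝ (newtonFar r₀ r₁)) (x' - y)) (u y) (u y)) with hI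
  have hG0 : ∀ (k : ℕ) (y : EuclideanSpace ℝ (Fin 3)), 0 ≤ 64 * c * R *
      (((2 : ℝ) ^ k * R)⁻¹ ^ 4 * (cutoff ((2 : ℝ) ^ (k + 1) * R) (a - y) * ‖u y‖ ^ 2)) := fun k y =>
    mul_nonneg (by positivity) (mul_nonneg (pow_nonneg (inv_nonneg.2 (by positivity)) 4)
      (mul_nonneg (cutoff_nonneg _ _) (sq_nonneg _)))
  have hGc : ∀ k : ℕ, Continuous fun y : EuclideanSpace ℝ (Fin 3) => 64 * c * R *
      (((2 : ℝ) ^ k * R)⁻¹ ^ 4 * (cutoff ((2 : ℝ) ^ (k + 1) * R) (a - y) * ‖u y‖ ^ 2)) := fun k =>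
    continuous_const.mul (continuous_const.mul
      (((contDiff_cutoff (n := 0) _).continuous.comp (continuous_const.sub continuous_id)).mul (hu.norm.pow 2)))
  have hGi : ∀ k : ℕ, Integrable fun y : EuclideanSpace ℝ (Fin 3) => 64 * c * R *
      (((2 : ℝ) ^ k * R)⁻¹ ^ 4 * (cutoff ((2 : ℝ) ^ (k + 1) * R) (a - y) * ‖u y‖ ^ 2)) := fun k =>
    ((integrable_cutoff_mul_norm_sq hu (by positivity) a).const_mul _).const_mul _
  have hGint : ∀ k : ℕ, (∫⁻ y, ENNReal.ofReal (64 * c * R *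
      (((2 : ℝ) ^ k * R)⁻¹ ^ 4 * (cutoff ((2 : ℝ) ^ (k + 1) * R) (a - y) * ‖u y‖ ^ 2)))) = ENNReal.ofReal (64 * c * R *
      (((2 : ℝ) ^ k * R)⁻¹ ^ 4 * ∫ y, cutoff ((2 : ℝ) ^ (k + 1) * R) (a - y) * ‖u y‖ ^ 2)) := by
    intro k
    rw [← ofReal_integral_eq_lintegral_ofReal (hGi k) (Eventually.of_forall (hG0 k)), integral_const_mul, integral_const_mul]
  have hsum : Summable fun k : ℕ => 64 * c * R *
      (((2 : ℝ) ^ k * R)⁻¹ ^ 4 * ∫ y, cutoff ((2 : ℝ) ^ (k + 1) * R) (a - y) * ‖u y‖ ^ 2) :=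
    (summable_dyadicEnergy hN hRpos a).mul_left _
  have hsum0 : ∀ k : ℕ, 0 ≤ 64 * c * R *
      (((2 : ℝ) ^ k * R)⁻¹ ^ 4 * ∫ y, cutoff ((2 : ℝ) ^ (k + 1) * R) (a - y) * ‖u y‖ ^ 2) := fun k =>
    mul_nonneg (by positivity) (mul_nonneg (pow_nonneg (inv_nonneg.2 (by positivity)) 4)
      (integral_nonneg fun y => mul_nonneg (cutoff_nonneg _ _) (sq_nonneg _)))
  have hS0 : 0 ≤ 64 * c * R * ∑' k : ℕ, ((2 : ℝ) ^ k * R)⁻¹ ^ 4 * ∫ y, cutoff ((2 : ℝ) ^ (k + 1) * R) (a - y) * ‖u y‖ ^ 2 :=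
    mul_nonneg (by positivity) (tsum_dyadicEnergy_nonneg R hRpos a)
  -- monotone convergence
  have hlin : (∫⁻ y, ENNReal.ofReal ‖I y‖) ≤ ENNReal.ofReal (64 * c * R *
      ∑' k : ℕ, ((2 : ℝ) ^ k * R)⁻¹ ^ 4 * ∫ y, cutoff ((2 : ℝ) ^ (k + 1) * R) (a - y) * ‖u y‖ ^ 2) := by
    calc (∫⁻ y, ENNReal.ofReal ‖I y‖)
        ≤ ∫⁻ y, ∑' k : ℕ, ENNReal.ofReal (64 * c * R *
            (((2 : ℝ) ^ k * R)⁻¹ ^ 4 * (cutoff ((2 : ℝ) ^ (k + 1) * R) (a - y) * ‖u y‖ ^ 2))) :=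
          lintegral_mono fun y => ofReal_norm_oscIntegrand_le_tsum h₀ h₁ hR hc0 hc hx hx' y
      _ = ∑' k : ℕ, ∫⁻ y, ENNReal.ofReal (64 * c * R *
            (((2 : ℝ) ^ k * R)⁻¹ ^ 4 * (cutoff ((2 : ℝ) ^ (k + 1) * R) (a - y) * ‖u y‖ ^ 2))) :=
          lintegral_tsum fun k => (hGc k).measurable.ennreal_ofReal.aemeasurable
      _ = ∑' k : ℕ, ENNReal.ofReal (64 * c * R *
            (((2 : ℝ) ^ k * R)⁻¹ ^ 4 * ∫ y, cutoff ((2 : ℝ) ^ (k + 1) * R) (a - y) * ‖u y‖ ^ 2)) := tsum_congr hGint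
      _ = ENNReal.ofReal (∑' k : ℕ, 64 * c * R *
            (((2 : ℝ) ^ k * R)⁻¹ ^ 4 * ∫ y, cutoff ((2 : ℝ) ^ (k + 1) * R) (a - y) * ‖u y‖ ^ 2)) :=
          (ENNReal.ofReal_tsum_of_nonneg hsum0 hsum).symm
      _ = _ := by rw [tsum_mul_left]
  rw [farRemainder_sub_eq_integral hu hN h₀ h₁ hRpos hw x x', ← Real.norm_eq_abs]
  calc ‖∫ y, I y‖ ≤ ENNReal.toReal (∫⁻ y, ENNReal.ofReal ‖I y‖) := norm_integral_le_lintegral_norm I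
    _ ≤ ENNReal.toReal (ENNReal.ofReal (64 * c * R *
          ∑' k : ℕ, ((2 : ℝ) ^ k * R)⁻¹ ^ 4 * ∫ y, cutoff ((2 : ℝ) ^ (k + 1) * R) (a - y) * ‖u y‖ ^ 2)) :=
        ENNReal.toReal_mono ENNReal.ofReal_ne_top hlin
    _ = _ := ENNReal.toReal_ofReal hS0

end Remainder

/-- **The `p₂`-clause of the window pressure split, with a universal constant.**  There is `κ₂ ≥ 0` such that for every continuous
bounded field `u` (`|u| ≤ N`), all scales `0 < r₀ < r₁ ≤ R`, every centre `a` and base point `x₀`, the harmonic remainder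
`p₂ = farPotential r₀ r₁ (ϑ•u) − farPotentialMod r₀ r₁ x₀ u` (`ϑ = cutoff (4R) (a − ·)`) has an oscillation bound `O ≥ 0` over
`B̄(a,2R)` with `O ≤ κ₂ · R · Σ'_k ((2^kR)⁻¹)⁴ ∫ cutoff(2^{k+1}R)(a−x)|u x|² dx` — verbatim the `p₂`-clause of `hwin` in
`…SparseEnergyScaledEnergyOfSplit.scaledEnergy_of_split`. [folklore] -/
theorem exists_farOscillation : ∃ κ₂ : ℝ, 0 ≤ κ₂ ∧
    ∀ (u : EuclideanSpace ℝ (Fin 3) → EuclideanSpace ℝ (Fin 3)), Continuous u → ∀ N : ℝ, (∀ y, ‖u y‖ ≤ N) →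
    ∀ (r₀ r₁ R : ℝ), 0 < r₀ → r₀ < r₁ → r₁ ≤ R → ∀ (a x₀ : EuclideanSpace ℝ (Fin 3)) (p₂ : EuclideanSpace ℝ (Fin 3) → ℝ),
    (p₂ = fun x => farPotential r₀ r₁ (fun y => cutoff (4 * R) (a - y) • u y) x - farPotentialMod r₀ r₁ x₀ u x) →
    ∃ O : ℝ, 0 ≤ O ∧ (∀ x ∈ closedBall a (2 * R), ∀ y ∈ closedBall a (2 * R), |p₂ x - p₂ y| ≤ O) ∧
      O ≤ κ₂ * R * ∑' k : ℕ, ((2 : ℝ) ^ k * R)⁻¹ ^ 4 * ∫ x, cutoff ((2 : ℝ) ^ (k + 1) * R) (a - x) * ‖u x‖ ^ 2 := by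
  obtain ⟨c, hc0, hc⟩ := exists_norm_fderiv3_newtonKernel_le
  refine ⟨64 * c, by positivity, fun u hu N hN r₀ r₁ R h₀ h₁ hR a x₀ p₂ hp₂ => ?_⟩
  have hRpos : 0 < R := (h₀.trans h₁).trans_le hR
  refine ⟨64 * c * R * ∑' k : ℕ, ((2 : ℝ) ^ k * R)⁻¹ ^ 4 * ∫ x, cutoff ((2 : ℝ) ^ (k + 1) * R) (a - x) * ‖u x‖ ^ 2,
    mul_nonneg (by positivity) (tsum_dyadicEnergy_nonneg R hRpos a), fun x hx y hy => ?_, le_of_eq (by ring)⟩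
  rw [hp₂]
  exact abs_farRemainder_sub_le hu hN h₀ h₁ hR hc0 hc rfl hx hy

end Summit.NavierStokesRegularity.NavierStokesRegularity.Theorems.PoloidalWindowDoorPoloidalWindowRigiditySparseEnergyFarOscillation

end
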